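import Literature.NumberTheory.LFunctions.WeilTwoPrimeDeflM72YDef
import HarnessLib

/-!
# Deflated two-prime certificate M72Y: the value of `κ`, `β₂₃ ≤ κ`, `κ − β₂₃ = κ'`, and the scalar side conditions

`weilCertDeflM72Y.kappaQ` evaluated by the kernel, the level identities, and `checkScalars` with `κ` rewritten to its value first. Pure proof file.
-/

noncomputable section

namespace Literature.NumberTheory.LFunctions

set_option maxHeartbeats 0 in
/-- **The value of `κ`** of certificate M72Y. [folklore] -/
theorem kappaQ_weilCertDeflM72Y : weilCertDeflM72Y.kappaQ = weilCertDeflM72YKappaLit := by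
  have h : decide (weilCertDeflM72Y.kappaQ = weilCertDeflM72YKappaLit) = true := by decide +kernel
  exact of_decide_eq_true h

/-- `β₂₃ ≤ κ` for certificate M72Y. [folklore] -/
theorem beta_le_kappaQ_weilCertDeflM72Y : weilCertDeflM72YBeta ≤ weilCertDeflM72Y.kappaQ := by
  rw [kappaQ_weilCertDeflM72Y]; unfold weilCertDeflM72YBeta weilCertDeflM72YKappaLit; norm_num

/-- `κ − β₂₃ = κ'` for certificate M72Y. [folklore] -/
theorem kappaQ_sub_beta_weilCertDeflM72Y : weilCertDeflM72Y.kappaQ - weilCertDeflM72YBeta = weilCertDeflM72YKappa' := by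
  rw [kappaQ_weilCertDeflM72Y]; unfold weilCertDeflM72YBeta weilCertDeflM72YKappaLit weilCertDeflM72YKappa'; norm_num

set_option maxHeartbeats 0 in
/-- **Kernel check of the scalar side conditions** of certificate M72Y. [folklore] -/
theorem checkScalars_weilCertDeflM72Y : weilCertDeflM72Y.checkScalars = true := by
  have h : weilCertDeflM72Y.checkScalars = (decide (1 ≤ weilCertDeflM72Y.j) && decide (0 < weilCertDeflM72Y.b) && decide (weilCertDeflM72Y.b ≤ weilCertDeflM72Y.base.a0) &&
      decide (weilCertDeflM72Y.base.a0 ≤ 1) && decide (0 < weilCertDeflM72Y.base.T) && decide (2 * weilCertDeflM72Y.base.a0 * weilCertDeflM72Y.base.T ≤ (weilCertDeflM72Y.base.N : ℚ) + 2) &&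
      decide (2 * (weilCertDeflM72Y.base.a0 * weilCertDeflM72Y.base.T) ^ (weilCertDeflM72Y.base.N + 1) / (weilCertDeflM72Y.base.N + 1).factorial ≤ 1) &&
      decide (weilCertDeflM72Y.base.N + 1 = 2 * weilCertDeflM72Y.base.nb) && decide (0 ≤ weilCertDeflM72Y.kappaQ)) := rfl
  rw [h, kappaQ_weilCertDeflM72Y]
  decide +kernel

end Literature.NumberTheory.LFunctions
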